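import Literature.MathematicalPhysics.QuantumFieldTheory.Balaban1983to89.B9Eq3133H1kPiTwoBackgroundLetterTower
import Literature.MathematicalPhysics.QuantumFieldTheory.Balaban1983to89.B9Eq3133H1kPiTwoBackgroundGradientLetterTower
import Literature.MathematicalPhysics.QuantumFieldTheory.Balaban1983to89.B9Eq3126H1kSliceGradRowClosed
import Literature.MathematicalPhysics.QuantumFieldTheory.Balaban1983to89.B9Eq3130GtildeMinusG1kGradRowsClosed
import Literature.MathematicalPhysics.QuantumFieldTheory.Balaban1983to89.B9Eq3126KTwoBackgroundLetterTower

/-!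
# `Balaban1983to89.B9Eq3153FrakGkPiMiddleWordTwoBackgroundGradientLetterTower` — T. Bałaban, *Propagators for lattice gauge theories in a background field*, Commun. Math. Phys. **99** (1985)
# 389–434 [Balaban1985BackgroundPropagators] (3.153) p. 431 *«𝔊 = G − HQG + c·DG′RG′D*»*, (3.122), (3.126) p. 420, (3.131)–(3.133) p. 422, Thm 3.4 p. 400, (3.3) p. 391; [Balaban1985Variational]
# (111) p. 294, (117) p. 295: **THE MIDDLE WORD `H̃_kQ_kG̃_k` OF PRINT's `𝔊̃_k`, TWO-BACKGROUND LADDER AT THE FLAT BASE, GRADIENT MEMBER (`∇_1`)** — for one-block fine-bond sources `f` over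
# the coarse block `v` with `‖f‖_∞ ≤ F`: `‖∇_1((H̃_k(U)Q_k(U)G̃_k(U) − H_k(1)Q_k(1)G_k(1))f)(b, μ)‖ ≤ (j₀ + α)·K·e^{−κ·d_m(Π(b₊), v)}·F`, constants BEFORE `n, η, m, U`; the companion of the
# value member `B9Eq3153FrakGkPiMiddleWordTwoBackgroundLetterTower` (same three words, the flat slice derivative post-composed with the LEFT factors)

statement-level skeleton of published theorems with citation tags; proofs where landed; nothing here is a claim about the Yang–Mills mass gap

CITATION HEADER (lean-in-tree rule).  Audit cell `pub-balaban`, sub-cell `t4`, BINDER row NE9; filed by NE9 crux-team LEAF PROVER 01 (`b2b-balaban-t4-ne9-formalise-leaf-01`, gen 101;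
ROUTE (J′), π-side, the `𝔊̃` storey; bears_on: R4/N22).  Composition BY NAME: gen 101's `B9Eq3133H1kPiTwoBackgroundGradientLetterTower.exists_gradLetter_H1kPi_sub_flat`,
`B9Eq3130GtildeMinusG1kGradRowsClosed.exists_local_rows_G1kPi_sub_G1k`; gen 100's `exists_letter_G1k_sub_flat`, `local_QkW_sub_flat`; the OWNER's (T4B) `exists_local_rows_G1kPi`
(MODEL rows — O-NE9-1, #5 UNRULED); ne9-leaf-05's `B9Eq3126H1kSliceGradRowClosed.exists_local_gradLetter_H1k` (at the vacuum, re-blocked to `Π(b₊)` at the cost `e^{κ₀}`),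
`letter_comp`, `letter_add`; ne9-leaf-03's `local_QkW`; `covGrad_apply_eq_slice`, `norm_covGrad_apply_le_of_slice`.  Source READ first-hand in the held text layer
`paper:balaban1985-cmp99-background-propagators` (journal page = PDF page + 388) pp. 391, 420–422, 431.  NOTHING of print's proofs is reproduced: [folklore] telescoping + letter compositions.

WHAT IS PROVED (sorry-free; proof lane — 0 `def`; [folklore]).  **`exists_gradLetter_middleWordPi_sub_flat`** — `∃ α₁ j₁ > 0, K ≥ 0, κ > 0` BEFORE the binder block of
`exists_letter_middleWordPi_sub_flat` VERBATIM `+ (μ : Fin d)`; conclusion as displayed above (the owner's α-convention rows are called at the radius `max(α, j₀)`).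
HONEST SCOPE.  Composition BY NAME on the cell's MODEL rows (O-NE9-1, #5 UNRULED); constants crude; flat-gradient member only; `j₀` and `α` displayed separately; the windows, `c₀ = η^d`,
unitarity, the tower data, `hαL`, the positivity and onto witnesses stay HYPOTHESES; nothing of [B9] (3.153) ∕ Thm 3.4 or [B11] (117) asserted as printed; «NE9 ⇐ the named binders»;
NE9 NOT PRINTED ∕ NOT PROVED; spine PROVED 0∕9; rung (B)+1 on a finite T⁴ — NOT infinite volume, NOT mass gap, NOT BetaPertH, NOT Clay.  HONEST DEPENDENCY: continuum YM on T⁴ ⇐ BetaPertH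
∧ nine spine estimates (0/9 proved); BetaPertH ⇐ (D1) ∧ (D4) ∧ CAP+tail; G-an2-4 gates asym, D1 and NE2/3/4.  NEW file; nothing modified.  Net new unproved facts: 0.
-/

noncomputable section

open scoped InnerProductSpace ComplexConjugate BigOperators

namespace Literature.MathematicalPhysics.QuantumFieldTheory.Balaban1983to89.B9Eq3153FrakGkPiMiddleWordTwoBackgroundGradientLetterTower

open B4Sect5Torus (TSite tdist tdist_nonneg tdist_triangle tdist_symm torusSum_le tdist_self)
open B4Sect5Proof (latticeConst latticeConst_nonneg)
open B9SectCLatticeCarrier (Bond bpos btgt shift unshift shift_unshift)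
open B9Eq311L2Pairing (WL2)
open B9Eq319QprimeTorus (blockCoord)
open B7Prop1Explicit (U1 Wcx boxVec)
open B11Eq103H1Complex (SiteL2K BondL2K G1LatticeK H1LatticeK)
open B9Eq310DeltaPrime (plaqHolU plaqHolU_one)
open B9Eq310HessianOperator (adTransportW)
open B9Eq315QTorus (perCfg cornerSite)
open B9Eq315QTower (towerP UlevOf)
open B9Eq315QTowerFlat (perCfg_UlevOf_one_mem_U1 norm_Wcx_UlevOf_one_sub_one_le UlevOf_one)
open B9Eq316TowerFlatIsOneStep (towerP_eq_fineP_pow siteCast)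
open B9Eq326OperatorTower (QkW laplaceAk G1k H1k)
open B9Eq324DeltaPrimeATower (laplacePrimeAk)
open B9Eq3119DeltaPiTower (laplaceAkPi)
open B9Eq315QkLocalLetter (local_QkW)
open B9Eq382BondPenaltyTwoBackgroundLetterTower (local_QkW_sub_flat)
open B9Eq326G1SupRowOfLetters (letter_comp letter_add)
open B9Eq3126H1kSliceGradRowClosed (exists_local_gradLetter_H1k)
open B9Eq326LocalPartTowerSliceGradientRow (covGrad_apply_eq_slice norm_covGrad_apply_le_of_slice)
open B9Eq33CovDerivVector (covGrad)
open B9Eq33CovDerivLocalLetterTower (tdist_bigBlock_bpos_btgt_le_one)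
open B11Eq103H1Complex (covDerivL2K)
open B9Eq386BondPropagatorTwoBackgroundLetterTower (exists_letter_G1k_sub_flat)
open B9Eq3130GtildeGradRowClosed (exists_local_rows_G1kPi)
open B9Eq3130GtildeMinusG1kGradRowsClosed (exists_local_rows_G1kPi_sub_G1k)
open B9Eq3133H1kPiTwoBackgroundGradientLetterTower (exists_gradLetter_H1kPi_sub_flat)

variable {d : ℕ} (hd : 1 ≤ d) (L : ℕ) [NeZero L] (hL : 1 ≤ L) (hL3 : 3 ≤ L)
  {𝔸 : Type*} [NormedRing 𝔸] [NormedAlgebra ℂ 𝔸] [CompleteSpace 𝔸] [NormOneClass 𝔸] [StarRing 𝔸] [NormedStarGroup 𝔸] [StarModule ℂ 𝔸] [FiniteDimensional ℂ 𝔸]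
  {W : Type*} [NormedAddCommGroup W] [InnerProductSpace ℂ W] [FiniteDimensional ℂ W] (φ : W ≃ₗ[ℂ] 𝔸)
  {Mφ Mφ' : ℝ} (hMφ : 0 ≤ Mφ) (hMφ' : 0 ≤ Mφ') (hφ : ∀ w, ‖φ w‖ ≤ Mφ * ‖w‖) (hφ' : ∀ X, ‖φ.symm X‖ ≤ Mφ' * ‖X‖) (hstar : ∀ X : 𝔸, ‖star X‖ ≤ ‖X‖)
  {a : ℝ} (ha : 0 < a) {a' : ℝ} (ha' : 0 < a') {ϱ : ℝ} (hϱ0 : 0 ≤ ϱ) (hϱ1 : ϱ < 1)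
  (τ : 𝔸 →ₗ[ℂ] ℂ) {Cτ : ℝ} (hτ : ∀ X, ‖τ X‖ ≤ Cτ * ‖X‖) (hCτ : 0 ≤ Cτ) {Mτ : ℝ} (hτm : ∀ X Y : 𝔸, ‖τ (X * Y)‖ ≤ Mτ * ‖X‖ * ‖Y‖) (hMτ : 0 ≤ Mτ)
  {ρw : ℝ} (hρw : 0 ≤ ρw)
  (hτ₁ : ∀ X : 𝔸, τ (star X) = conj (τ X)) (hτ₂ : ∀ X Y : 𝔸, τ (X * Y) = τ (Y * X)) (hφτ : ∀ X Y : 𝔸, ⟪φ.symm X, φ.symm Y⟫_ℂ = τ (star X * Y))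
  (AQ : ℝ)
  {ι : Type} [Fintype ι] [DecidableEq ι] (b : Module.Basis ι ℝ 𝔸) {M₂ : ℝ} (hM₂ : 0 ≤ M₂) (hrepr : ∀ (v : 𝔸) (i : ι), |b.repr v i| ≤ M₂ * ‖v‖)

include hd hL hL3 hMφ hMφ' hφ hφ' hstar ha ha' hϱ0 hϱ1 hτ hCτ hτm hMτ hρw hτ₁ hτ₂ hφτ hM₂ hrepr in
set_option maxHeartbeats 3200000 in
set_option maxRecDepth 8192 in
/-- **THE MIDDLE WORD `H̃_kQ_kG̃_k` OF PRINT's `𝔊̃_k`, TWO-BACKGROUND LADDER AT THE FLAT BASE, GRADIENT MEMBER (`∇_1`)** — see the module docstring. [folklore]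
[cite: Balaban1985BackgroundPropagators, (3.153) p.431, (3.122) p.420, (3.126) p.420, (3.131)–(3.133) p.422, Thm 3.4 p.400; Balaban1985Variational, (111) p.294, (117) p.295] -/
theorem exists_gradLetter_middleWordPi_sub_flat :
    ∃ α₁ j₁ K κ : ℝ, 0 < α₁ ∧ 0 < j₁ ∧ 0 ≤ K ∧ 0 < κ ∧
      ∀ (n : ℕ) (η : ℝ) (_hηL : η * (L : ℝ) ^ (n + 1) = 1) (c₀ c₁ : ℝ) [Fact (0 < c₀)] [Fact (0 < c₁)]
        (_hw : c₀ * ((L : ℝ) ^ (n + 1)) ^ d = c₁) (_hρ : |η| ^ d / c₀ ≤ ρw) (m : Fin d → ℕ) [∀ i, NeZero (m i)] (_hm : ∀ i, 1 ≤ m i)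
        (U : Bond d (towerP L m (n + 1)) → 𝔸ˣ) (αU : ℕ → ℝ) (_hα0 : ∀ j, 0 ≤ αU j) (hα1 : ∀ j, αU j ≤ 1 / 64)
        (hαL : ∀ j, 50 * (d + 1) * αU j * (L : ℝ) ^ d ≤ 1 / 2)
        (hU1 : ∀ (j : ℕ) (x : B7Prop1Explicit.Site d) (k : Fin d), perCfg (towerP L m (j + 1)) (UlevOf L m (n + 1) U j) x k ∈ U1 𝔸)
        (hreg : ∀ (j : ℕ) (y : TSite d (towerP L m j)) (k : Fin d) (ρ' : Fin d → Fin L),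
          ‖((Wcx L (perCfg (towerP L m (j + 1)) (UlevOf L m (n + 1) U j)) (cornerSite L y) k (boxVec L ρ') : 𝔸ˣ) : 𝔸) - 1‖ ≤ αU j)
        (εU : ℕ → ℝ) (_hεU : ∀ j, 0 ≤ εU j) (_hε1 : ∀ j, εU j ≤ 1) (_hUε : ∀ (j : ℕ) (b : Bond d (towerP L m (j + 1))), ‖(UlevOf L m (n + 1) U j b : 𝔸) - 1‖ ≤ εU j)
        (_hLb : ∀ (j : ℕ) (b : Bond d (towerP L m (j + 1))), UlevOf L m (n + 1) U j b ∈ U1 𝔸)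
        (α : ℝ) (_hα : 0 ≤ α) (_hαle : α ≤ α₁)
        (hUst : ∀ b, star (U b : 𝔸) = (((U b)⁻¹ : 𝔸ˣ) : 𝔸)) (_hUb : ∀ b, U b ∈ U1 𝔸) (_hUη : ∀ b, ‖(U b : 𝔸) - 1‖ ≤ α * η)
        (_hUw : ∀ (x : TSite d (towerP L m (n + 1))) (μ ν : Fin d), ‖(U (shift ν x, μ) : 𝔸) - (U (x, μ) : 𝔸)‖ ≤ α * η ^ 2)
        (_hpl : ∀ p : B9SectCLatticeCarrier.Plaq d (towerP L m (n + 1)), ‖(plaqHolU U p : 𝔸) - 1‖ ≤ α * η ^ 2)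
        (_hUgrad : ∀ (x : TSite d (towerP L m (n + 1))) (μ : Fin d), ‖(U (x, μ) : 𝔸) - U (unshift μ x, μ)‖ ≤ α * η ^ 2)
        (_hRlev : ∀ (j : ℕ) (b : Bond d (towerP L m (j + 1))) (w : W), ‖adTransportW φ (UlevOf L m (n + 1) U j) b w‖ ≤ ‖w‖)
        (_hεg : ∀ j < n + 1, εU j ≤ α * ϱ ^ j) (_hAQ : ∑ j ∈ Finset.range (n + 1), αU j ≤ AQ)
        (hpos' : ∀ x : SiteL2K ℂ d (towerP L m (n + 1)) c₀ W, x ≠ 0 → 0 < RCLike.re ⟪x, laplacePrimeAk L m n φ η U a' (c₁ := c₁) x⟫_ℂ)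
        (hpos : ∀ x : BondL2K ℂ d (towerP L m (n + 1)) c₀ W, x ≠ 0 →
          0 < RCLike.re ⟪x, laplaceAk L m n φ η U hL αU hα1 hU1 hreg τ (c₀ := c₀) (c₁ := c₁) a x⟫_ℂ)
        (_hc₀η : c₀ = η ^ d) (j₀ : ℝ) (_hJ : ∀ μ y, ‖B9Eq39Adjoint.J (fun μ => B9Eq33CovDerivVector.shiftEquiv μ) (fun μ y => U (y, μ)) η μ y‖ ≤ j₀) (_hj : j₀ ≤ j₁)
        (hposπ : ∀ x : BondL2K ℂ d (towerP L m (n + 1)) c₀ W, x ≠ 0 →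
          0 < RCLike.re ⟪x, laplaceAkPi L m n φ τ η U a' hpos' hL αU hα1 hU1 hreg (c₁ := c₁) a x⟫_ℂ)
        (hQ : Function.Surjective (QkW L m n φ U hL αU hα1 hU1 hreg (c₀ := c₀) (c₁ := c₁)))
        (hpos'₁ : ∀ x : SiteL2K ℂ d (towerP L m (n + 1)) c₀ W, x ≠ 0 →
          0 < RCLike.re ⟪x, laplacePrimeAk L m n φ η (fun _ : Bond d (towerP L m (n + 1)) => (1 : 𝔸ˣ)) a' (c₁ := c₁) x⟫_ℂ)
        (hpos₁ : ∀ x : BondL2K ℂ d (towerP L m (n + 1)) c₀ W, x ≠ 0 →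
          0 < RCLike.re ⟪x, laplaceAk L m n φ η (fun _ : Bond d (towerP L m (n + 1)) => (1 : 𝔸ˣ)) hL (fun _ => 0) (fun _ => by norm_num)
            (perCfg_UlevOf_one_mem_U1 L m (n + 1)) (norm_Wcx_UlevOf_one_sub_one_le L m (n + 1) (fun _ => 0) (fun _ => le_rfl)) τ
            (c₀ := c₀) (c₁ := c₁) a x⟫_ℂ)
        (v : TSite d m) (f : BondL2K ℂ d (towerP L m (n + 1)) c₀ W) (F : ℝ)
        (_hfv : ∀ b', blockCoord (L ^ (n + 1)) m (siteCast (towerP_eq_fineP_pow L m (n + 1)) (bpos b')) ≠ v → WL2.equiv ℂ (fun _ : Bond d (towerP L m (n + 1)) => c₀) W f b' = 0)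
        (_hfF : ∀ b', ‖WL2.equiv ℂ (fun _ : Bond d (towerP L m (n + 1)) => c₀) W f b'‖ ≤ F) (μ : Fin d) (bd : Bond d (towerP L m (n + 1))),
        ‖covGrad ((η : ℂ))⁻¹ (adTransportW φ (fun _ : Bond d (towerP L m (n + 1)) => (1 : 𝔸ˣ))) (WL2.equiv ℂ (fun _ : Bond d (towerP L m (n + 1)) => c₀) W
            (H1LatticeK hposπ hQ (QkW L m n φ U hL αU hα1 hU1 hreg (c₀ := c₀) (c₁ := c₁) (G1LatticeK hposπ f)) -
              H1k L m n φ η (fun _ : Bond d (towerP L m (n + 1)) => (1 : 𝔸ˣ)) hL (fun _ => 0) (fun _ => by norm_num)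
                (perCfg_UlevOf_one_mem_U1 L m (n + 1)) (norm_Wcx_UlevOf_one_sub_one_le L m (n + 1) (fun _ => 0) (fun _ => le_rfl)) τ (c₀ := c₀) (c₁ := c₁)
                (fun _ => by norm_num) hpos₁
                (QkW L m n φ (fun _ : Bond d (towerP L m (n + 1)) => (1 : 𝔸ˣ)) hL (fun _ => 0) (fun _ => by norm_num)
                (perCfg_UlevOf_one_mem_U1 L m (n + 1)) (norm_Wcx_UlevOf_one_sub_one_le L m (n + 1) (fun _ => 0) (fun _ => le_rfl)) (c₀ := c₀) (c₁ := c₁)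
                  (G1k L m n φ η (fun _ : Bond d (towerP L m (n + 1)) => (1 : 𝔸ˣ)) hL (fun _ => 0) (fun _ => by norm_num)
                (perCfg_UlevOf_one_mem_U1 L m (n + 1)) (norm_Wcx_UlevOf_one_sub_one_le L m (n + 1) (fun _ => 0) (fun _ => le_rfl)) τ (c₀ := c₀) (c₁ := c₁) hpos₁ f)))) (bd, μ)‖ ≤
          (j₀ + α) * K * Real.exp (-(κ * tdist m (blockCoord (L ^ (n + 1)) m (siteCast (towerP_eq_fineP_pow L m (n + 1)) (btgt bd))) v)) * F := by
  classical
  obtain ⟨αT, BT, δT, hαT, hBT, hδT, HT⟩ :=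
    exists_local_rows_G1kPi hd L hL hL3 φ hMφ hMφ' hφ hφ' hstar ha ha' hϱ0 hϱ1 τ hτ hCτ hτm hMτ hρw hτ₁ hτ₂ hφτ AQ
  obtain ⟨αR, BR, δR, hαR, hBR, hδR, HR⟩ :=
    exists_local_rows_G1kPi_sub_G1k hd L hL hL3 φ hMφ hMφ' hφ hφ' hstar ha ha' hϱ0 hϱ1 τ hτ hCτ hτm hMτ hρw hτ₁ hτ₂ hφτ AQ
  obtain ⟨αS, KS, κS, hαS, hKS, hκS, HS⟩ :=
    exists_letter_G1k_sub_flat hd L hL hL3 φ hMφ hMφ' hφ hφ' hstar ha ha' hϱ0 hϱ1 τ hτ hCτ hτm hMτ hρw hτ₁ hτ₂ hφτ b hM₂ hrepr AQ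
  obtain ⟨αH, BH, δH, hαH, hBH, hδH, ROWH⟩ :=
    exists_local_gradLetter_H1k hd L hL hL3 φ hMφ hMφ' hφ hφ' hstar ha ha' hϱ0 hϱ1 τ hτ hCτ hτm hMτ hρw hτ₁ hτ₂ hφτ AQ
  obtain ⟨αP, jP, KP, κP, hαP, hjP, hKP, hκP, HPH⟩ :=
    exists_gradLetter_H1kPi_sub_flat hd L hL hL3 φ hMφ hMφ' hφ hφ' hstar ha ha' hϱ0 hϱ1 τ hτ hCτ hτm hMτ hρw hτ₁ hτ₂ hφτ AQ b hM₂ hrepr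
  set κ₀ : ℝ := min (min (min δT δR) (min κS δH)) κP with hκ₀
  have hκ₀0 : 0 < κ₀ := lt_min (lt_min (lt_min hδT hδR) (lt_min hκS hδH)) hκP
  have hκ₀T : κ₀ ≤ δT := ((min_le_left _ _).trans (min_le_left _ _)).trans (min_le_left _ _)
  have hκ₀R : κ₀ ≤ δR := ((min_le_left _ _).trans (min_le_left _ _)).trans (min_le_right _ _)
  have hκ₀S : κ₀ ≤ κS := ((min_le_left _ _).trans (min_le_right _ _)).trans (min_le_left _ _)
  have hκ₀H : κ₀ ≤ δH := ((min_le_left _ _).trans (min_le_right _ _)).trans (min_le_right _ _)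
  have hκ₀P : κ₀ ≤ κP := min_le_right _ _
  set S : ℝ := latticeConst d (κ₀ / 2) with hS
  have hS0 : 0 ≤ S := latticeConst_nonneg d (half_pos hκ₀0).le
  set θ : ℝ := 102 * ((d : ℝ) + 1) ^ 2 * L with hθ
  set EQ : ℝ := Real.exp (50 * ((d : ℝ) + 1) * AQ) with hEQ
  set KQU : ℝ := Mφ' * Mφ * EQ * Real.exp κ₀ with hKQU
  set KQ1 : ℝ := Mφ' * Mφ * Real.exp κ₀ with hKQ1
  set KQd : ℝ := Mφ' * Mφ * (EQ * θ * (1 / (1 - ϱ))) * Real.exp κ₀ with hKQd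
  have hϱ' : 0 < 1 - ϱ := by linarith
  obtain ⟨hKQU0, hKQ10, hKQd0⟩ : 0 ≤ KQU ∧ 0 ≤ KQ1 ∧ 0 ≤ KQd := ⟨by positivity, by positivity, by positivity⟩
  set BH' : ℝ := BH * Real.exp κ₀ with hBH'
  have hBH'0 : 0 ≤ BH' := by positivity
  set K : ℝ := BT * KQU * S * KP * S + BT * KQd * S * BH' * S + (BR + KS) * KQ1 * S * BH' * S with hK
  have hK0 : 0 ≤ K := by positivity
  refine ⟨min (min (min αT αR) (min αS αH)) (min αP 1), min (min αT αR) jP, K, κ₀ / 2,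
    lt_min (lt_min (lt_min hαT hαR) (lt_min hαS hαH)) (lt_min hαP one_pos), lt_min (lt_min hαT hαR) hjP, hK0, half_pos hκ₀0, ?_⟩
  intro n η hηL c₀ c₁ _ _ hw hρ m _ hm U αU hα0 hα1 hαL hU1 hreg εU hεU hε1 hUε hLb α hα hαle hUst hUb hUη hUw hpl hUgrad hRlev hεg hAQ hpos' hpos hc₀η j₀ hJ hj
    hposπ hQ hpos'₁ hpos₁ v f F hfv hfF μ bd
  have hαT' : α ≤ αT := hαle.trans (((min_le_left _ _).trans (min_le_left _ _)).trans (min_le_left _ _))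
  have hαR' : α ≤ αR := hαle.trans (((min_le_left _ _).trans (min_le_left _ _)).trans (min_le_right _ _))
  have hαS' : α ≤ αS := hαle.trans (((min_le_left _ _).trans (min_le_right _ _)).trans (min_le_left _ _))
  have hαH' : α ≤ αH := hαle.trans (((min_le_left _ _).trans (min_le_right _ _)).trans (min_le_right _ _))
  have hαP' : α ≤ αP := hαle.trans ((min_le_right _ _).trans (min_le_left _ _))
  have hα1' : α ≤ 1 := hαle.trans ((min_le_right _ _).trans (min_le_right _ _))
  have hjT' : j₀ ≤ αT := hj.trans ((min_le_left _ _).trans (min_le_left _ _))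
  have hjR' : j₀ ≤ αR := hj.trans ((min_le_left _ _).trans (min_le_right _ _))
  have hjP' : j₀ ≤ jP := hj.trans (min_le_right _ _)
  have hc₀ : (0 : ℝ) < c₀ := Fact.out
  haveI : Nonempty (Bond d (towerP L m (n + 1))) := ⟨bd⟩
  have y₀ : TSite d (towerP L m (n + 1)) := fun _ => 0
  haveI : Nonempty (Bond d m) := ⟨(v, ⟨0, hd⟩)⟩
  have hF : 0 ≤ F := (norm_nonneg _).trans (hfF bd)
  have hj₀ : 0 ≤ j₀ := (norm_nonneg _).trans (hJ ⟨0, hd⟩ y₀)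
  have hAQ0 : 0 ≤ AQ := (Finset.sum_nonneg fun j _ => hα0 j).trans hAQ
  have hLpos : (0 : ℝ) < (L : ℝ) ^ (n + 1) := pow_pos (by exact_mod_cast Nat.pos_of_ne_zero (NeZero.ne L)) _
  have hη : 0 < η := by
    by_contra h; push Not at h; nlinarith [mul_nonpos_of_nonpos_of_nonneg h hLpos.le]
  set α' : ℝ := max α j₀ with hα'
  have hα'0 : 0 ≤ α' := hα.trans (le_max_left _ _)
  have hαα' : α ≤ α' := le_max_left _ _
  have hα'T : α' ≤ αT := max_le hαT' hjT'
  have hα'R : α' ≤ αR := max_le hαR' hjR'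
  have hα'le : α' ≤ j₀ + α := max_le (by linarith) (by linarith)
  have hUη' : ∀ b', ‖(U b' : 𝔸) - 1‖ ≤ α' * η := fun b' => (hUη b').trans (by gcongr)
  have hpl' : ∀ p : B9SectCLatticeCarrier.Plaq d (towerP L m (n + 1)), ‖(plaqHolU U p : 𝔸) - 1‖ ≤ α' * η ^ 2 := fun p => (hpl p).trans (by gcongr)
  have hUgrad' : ∀ (x : TSite d (towerP L m (n + 1))) (μ' : Fin d), ‖(U (x, μ') : 𝔸) - U (unshift μ' x, μ')‖ ≤ α' * η ^ 2 := fun x μ' =>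
    (hUgrad x μ').trans (by gcongr)
  have hεg' : ∀ j < n + 1, εU j ≤ α' * ϱ ^ j := fun j hj' => (hεg j hj').trans (mul_le_mul_of_nonneg_right hαα' (pow_nonneg hϱ0 j))
  have hJ' : ∀ (μ' : Fin d) (y : TSite d (towerP L m (n + 1))),
      ‖B9Eq39Adjoint.J (fun μ => B9Eq33CovDerivVector.shiftEquiv μ) (fun μ y => U (y, μ)) η μ' y‖ ≤ α' := fun μ' y => (hJ μ' y).trans (le_max_right _ _)
  have hαL1 : ∀ j : ℕ, 50 * (d + 1) * (fun _ : ℕ => (0 : ℝ)) j * (L : ℝ) ^ d ≤ 1 / 2 := fun _ => by norm_num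
  have hUε1 : ∀ (j : ℕ) (b' : Bond d (towerP L m (j + 1))), ‖(UlevOf L m (n + 1) (fun _ : Bond d (towerP L m (n + 1)) => (1 : 𝔸ˣ)) j b' : 𝔸) - 1‖ ≤ (fun _ : ℕ => (0 : ℝ)) j :=
    fun j b' => by rw [UlevOf_one]; simp
  have hLb1 : ∀ (j : ℕ) (b' : Bond d (towerP L m (j + 1))), UlevOf L m (n + 1) (fun _ : Bond d (towerP L m (n + 1)) => (1 : 𝔸ˣ)) j b' ∈ U1 𝔸 := fun j b' => by
    rw [UlevOf_one]; exact one_mem _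
  have hRlev1 : ∀ (j : ℕ) (b' : Bond d (towerP L m (j + 1))) (w : W), ‖adTransportW φ (UlevOf L m (n + 1) (fun _ : Bond d (towerP L m (n + 1)) => (1 : 𝔸ˣ)) j) b' w‖ ≤ ‖w‖ :=
    fun j b' w => by rw [UlevOf_one, B5Eq172HodgePositivity.adTransportW_one, LinearMap.id_apply]
  have hUst1 : ∀ b' : Bond d (towerP L m (n + 1)), star ((fun _ : Bond d (towerP L m (n + 1)) => (1 : 𝔸ˣ)) b' : 𝔸) = ((((fun _ : Bond d (towerP L m (n + 1)) => (1 : 𝔸ˣ)) b')⁻¹ : 𝔸ˣ) : 𝔸) := fun _ => by simp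
  have hUb1 : ∀ b' : Bond d (towerP L m (n + 1)), (fun _ : Bond d (towerP L m (n + 1)) => (1 : 𝔸ˣ)) b' ∈ U1 𝔸 := fun _ => one_mem _
  have hUη1 : ∀ b' : Bond d (towerP L m (n + 1)), ‖(((fun _ : Bond d (towerP L m (n + 1)) => (1 : 𝔸ˣ)) b' : 𝔸ˣ) : 𝔸) - 1‖ ≤ 0 * η := fun _ => by simp
  have hpl1 : ∀ p : B9SectCLatticeCarrier.Plaq d (towerP L m (n + 1)), ‖(plaqHolU (fun _ : Bond d (towerP L m (n + 1)) => (1 : 𝔸ˣ)) p : 𝔸) - 1‖ ≤ 0 * η ^ 2 := fun _ => by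
    simp [plaqHolU_one]
  have hUgrad1 : ∀ (x : TSite d (towerP L m (n + 1))) (μ : Fin d), ‖(((fun _ : Bond d (towerP L m (n + 1)) => (1 : 𝔸ˣ)) (x, μ) : 𝔸ˣ) : 𝔸) - (fun _ : Bond d (towerP L m (n + 1)) => (1 : 𝔸ˣ)) (unshift μ x, μ)‖ ≤ 0 * η ^ 2 :=
    fun _ _ => by simp
  have hεg1 : ∀ j < n + 1, (fun _ : ℕ => (0 : ℝ)) j ≤ 0 * ϱ ^ j := fun _ _ => by simp
  have hAQ1 : ∑ j ∈ Finset.range (n + 1), (fun _ : ℕ => (0 : ℝ)) j ≤ AQ := by simpa using hAQ0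
  set piS : TSite d (towerP L m (n + 1)) → TSite d m := fun x => blockCoord (L ^ (n + 1)) m (siteCast (towerP_eq_fineP_pow L m (n + 1)) x) with hpiS
  set piB : Bond d (towerP L m (n + 1)) → TSite d m := fun b' => piS (bpos b') with hpiB
  set piC : Bond d m → TSite d m := fun c' => c'.1 with hpiC
  set piT : Bond d (towerP L m (n + 1)) → TSite d m := fun b' => piS (btgt b') with hpiT
  have hone := tdist_bigBlock_bpos_btgt_le_one L m (n + 1) hm
  obtain ⟨Dcl1, hDcl1⟩ : ∃ T : BondL2K ℂ d (towerP L m (n + 1)) c₀ W →L[ℂ] BondL2K ℂ d (towerP L m (n + 1)) c₀ W,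
      ∀ (u : BondL2K ℂ d (towerP L m (n + 1)) c₀ W) (b' : Bond d (towerP L m (n + 1))),
        WL2.equiv ℂ (fun _ : Bond d (towerP L m (n + 1)) => c₀) W (T u) b' =
          WL2.equiv ℂ (fun _ : Bond d (towerP L m (n + 1)) => c₀) W (covDerivL2K ℂ c₀ ((η : ℂ))⁻¹ (adTransportW φ (fun _ : Bond d (towerP L m (n + 1)) => (1 : 𝔸ˣ)))
            ((WL2.equiv ℂ (fun _ : TSite d (towerP L m (n + 1)) => c₀) W).symm fun y =>
              WL2.equiv ℂ (fun _ : Bond d (towerP L m (n + 1)) => c₀) W u (y, μ))) b' :=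
    ⟨LinearMap.toContinuousLinearMap (covDerivL2K ℂ c₀ ((η : ℂ))⁻¹ (adTransportW φ (fun _ : Bond d (towerP L m (n + 1)) => (1 : 𝔸ˣ))) ∘ₗ
        (WL2.linearEquiv ℂ ℂ (fun _ : TSite d (towerP L m (n + 1)) => c₀)).symm.toLinearMap ∘ₗ
        LinearMap.funLeft ℂ W (fun y : TSite d (towerP L m (n + 1)) => ((y, μ) : Bond d (towerP L m (n + 1)))) ∘ₗ
        (WL2.linearEquiv ℂ ℂ (fun _ : Bond d (towerP L m (n + 1)) => c₀)).toLinearMap), fun _ _ => rfl⟩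
  set Gt := G1LatticeK hposπ with hGt
  set GU := G1k L m n φ η U hL αU hα1 hU1 hreg τ (c₀ := c₀) (c₁ := c₁) hpos with hGU
  set G1 := G1k L m n φ η (fun _ : Bond d (towerP L m (n + 1)) => (1 : 𝔸ˣ)) hL (fun _ => 0) (fun _ => by norm_num)
                (perCfg_UlevOf_one_mem_U1 L m (n + 1)) (norm_Wcx_UlevOf_one_sub_one_le L m (n + 1) (fun _ => 0) (fun _ => le_rfl)) τ (c₀ := c₀) (c₁ := c₁) hpos₁ with hG1
  set QU := QkW L m n φ U hL αU hα1 hU1 hreg (c₀ := c₀) (c₁ := c₁) with hQU'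
  set Q1 := QkW L m n φ (fun _ : Bond d (towerP L m (n + 1)) => (1 : 𝔸ˣ)) hL (fun _ => 0) (fun _ => by norm_num)
                (perCfg_UlevOf_one_mem_U1 L m (n + 1)) (norm_Wcx_UlevOf_one_sub_one_le L m (n + 1) (fun _ => 0) (fun _ => le_rfl)) (c₀ := c₀) (c₁ := c₁) with hQ1'
  set HP := H1LatticeK hposπ hQ with hHP
  set H1 := H1k L m n φ η (fun _ : Bond d (towerP L m (n + 1)) => (1 : 𝔸ˣ)) hL (fun _ => 0) (fun _ => by norm_num)
                (perCfg_UlevOf_one_mem_U1 L m (n + 1)) (norm_Wcx_UlevOf_one_sub_one_le L m (n + 1) (fun _ => 0) (fun _ => le_rfl)) τ (c₀ := c₀) (c₁ := c₁)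
                (fun _ => by norm_num) hpos₁ with hH1
  obtain ⟨TGt, hTGt⟩ : ∃ T : BondL2K ℂ d (towerP L m (n + 1)) c₀ W →L[ℂ] BondL2K ℂ d (towerP L m (n + 1)) c₀ W, T = LinearMap.toContinuousLinearMap Gt := ⟨_, rfl⟩
  obtain ⟨TGdd, hTGdd⟩ : ∃ T : BondL2K ℂ d (towerP L m (n + 1)) c₀ W →L[ℂ] BondL2K ℂ d (towerP L m (n + 1)) c₀ W, T = LinearMap.toContinuousLinearMap (Gt - G1) :=
    ⟨_, rfl⟩
  obtain ⟨TQU, hTQU⟩ : ∃ T : BondL2K ℂ d (towerP L m (n + 1)) c₀ W →L[ℂ] BondL2K ℂ d m c₁ W, T = LinearMap.toContinuousLinearMap QU := ⟨_, rfl⟩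
  obtain ⟨TQ1, hTQ1⟩ : ∃ T : BondL2K ℂ d (towerP L m (n + 1)) c₀ W →L[ℂ] BondL2K ℂ d m c₁ W, T = LinearMap.toContinuousLinearMap Q1 := ⟨_, rfl⟩
  obtain ⟨TQd, hTQd⟩ : ∃ T : BondL2K ℂ d (towerP L m (n + 1)) c₀ W →L[ℂ] BondL2K ℂ d m c₁ W, T = LinearMap.toContinuousLinearMap (QU - Q1) := ⟨_, rfl⟩
  obtain ⟨THd, hTHd⟩ : ∃ T : BondL2K ℂ d m c₁ W →L[ℂ] BondL2K ℂ d (towerP L m (n + 1)) c₀ W, T = LinearMap.toContinuousLinearMap (HP - H1) := ⟨_, rfl⟩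
  obtain ⟨TH1, hTH1⟩ : ∃ T : BondL2K ℂ d m c₁ W →L[ℂ] BondL2K ℂ d (towerP L m (n + 1)) c₀ W, T = LinearMap.toContinuousLinearMap H1 := ⟨_, rfl⟩
  have hweak : ∀ {r' : ℝ} (t : ℝ), κ₀ ≤ r' → 0 ≤ t → Real.exp (-(r' * t)) ≤ Real.exp (-(κ₀ * t)) := fun t hr ht => Real.exp_le_exp.mpr (by nlinarith)
  have hLGt : ∀ (w : TSite d m) (g : BondL2K ℂ d (towerP L m (n + 1)) c₀ W) (F : ℝ), (∀ x, piB x ≠ w → WL2.equiv ℂ (fun _ : Bond d (towerP L m (n + 1)) => c₀) W g x = 0) →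
      (∀ x, ‖WL2.equiv ℂ (fun _ : Bond d (towerP L m (n + 1)) => c₀) W g x‖ ≤ F) → ∀ b', ‖WL2.equiv ℂ (fun _ : Bond d (towerP L m (n + 1)) => c₀) W (TGt g) b'‖ ≤ BT * Real.exp (-(κ₀ * tdist m (piB b') w)) * F := by
    intro w g F hgv hgF b'
    have hF : 0 ≤ F := (norm_nonneg _).trans (hgF b')
    rw [hTGt, LinearMap.coe_toContinuousLinearMap']
    refine ((HT n η hηL c₀ c₁ hw hρ m hm U αU hα0 hα1 hU1 hreg εU hεU hUε hLb α' hα'0 hα'T hUst hUb hUη' hpl' hUgrad' hRlev hεg' hAQ hpos' hpos hposπ hc₀η hJ'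
      w g F hgv hgF ⟨0, hd⟩ b' y₀).1).trans ?_
    exact mul_le_mul_of_nonneg_right (mul_le_mul_of_nonneg_left (hweak _ hκ₀T (tdist_nonneg m _ _)) hBT) hF
  have hLGdd : ∀ (w : TSite d m) (g : BondL2K ℂ d (towerP L m (n + 1)) c₀ W) (F : ℝ), (∀ x, piB x ≠ w → WL2.equiv ℂ (fun _ : Bond d (towerP L m (n + 1)) => c₀) W g x = 0) →
      (∀ x, ‖WL2.equiv ℂ (fun _ : Bond d (towerP L m (n + 1)) => c₀) W g x‖ ≤ F) → ∀ b', ‖WL2.equiv ℂ (fun _ : Bond d (towerP L m (n + 1)) => c₀) W (TGdd g) b'‖ ≤ (α' * BR + KS * α) * Real.exp (-(κ₀ * tdist m (piB b') w)) * F := by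
    intro w g F hgv hgF b'
    have hF : 0 ≤ F := (norm_nonneg _).trans (hgF b')
    have e : TGdd g = (Gt g - GU g) + (GU g - G1 g) := by
      rw [hTGdd, LinearMap.coe_toContinuousLinearMap', LinearMap.sub_apply]; abel
    rw [e, WL2.equiv_add, Pi.add_apply]
    have h1 := ((HR n η hηL c₀ c₁ hw hρ m hm U αU hα0 hα1 hU1 hreg εU hεU hUε hLb α' hα'0 hα'R hUst hUb hUη' hpl' hUgrad' hRlev hεg' hAQ hpos' hpos hposπ hc₀η hJ'
      w g F hgv hgF ⟨0, hd⟩ b' y₀).1).trans (mul_le_mul_of_nonneg_right (mul_le_mul_of_nonneg_left (hweak _ hκ₀R (tdist_nonneg m _ _)) (mul_nonneg hα'0 hBR)) hF)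
    have h2 := (HS n η hηL c₀ c₁ hw hρ m hm U α hα hαS' hUb hUη hUw hpl hUst αU hα0 hα1 hAQ hU1 hreg εU hεU hε1 hεg hUε hLb hRlev hpos' hpos hpos'₁ hpos₁
      w g F hgv hgF b').trans (mul_le_mul_of_nonneg_right (mul_le_mul_of_nonneg_left (hweak _ hκ₀S (tdist_nonneg m _ _)) (mul_nonneg hKS hα)) hF)
    rw [WL2.equiv_sub, Pi.sub_apply] at h1 h2
    refine (norm_add_le _ _).trans ((add_le_add h1 h2).trans (le_of_eq (by ring)))
  have hPA : ∏ j ∈ Finset.range (n + 1), (1 + 50 * ((d : ℝ) + 1) * αU j) ≤ EQ := by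
    calc ∏ j ∈ Finset.range (n + 1), (1 + 50 * ((d : ℝ) + 1) * αU j) ≤ ∏ j ∈ Finset.range (n + 1), Real.exp (50 * ((d : ℝ) + 1) * αU j) :=
          Finset.prod_le_prod (fun j _ => by have := hα0 j; positivity) fun j _ => by linarith [Real.add_one_le_exp (50 * ((d : ℝ) + 1) * αU j)]
      _ = Real.exp (50 * ((d : ℝ) + 1) * ∑ j ∈ Finset.range (n + 1), αU j) := by rw [← Real.exp_sum, Finset.mul_sum]
      _ ≤ EQ := Real.exp_le_exp.mpr (mul_le_mul_of_nonneg_left hAQ (by positivity))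
  have hSε : ∑ j ∈ Finset.range (n + 1), εU j ≤ α * (1 / (1 - ϱ)) := by
    have h1 : ∑ j ∈ Finset.range (n + 1), εU j ≤ ∑ j ∈ Finset.range (n + 1), α * ϱ ^ j :=
      Finset.sum_le_sum fun j hj' => hεg j (Finset.mem_range.mp hj')
    have h2 : ∑ j ∈ Finset.range (n + 1), α * ϱ ^ j ≤ α * (1 / (1 - ϱ)) := by
      rw [← Finset.mul_sum]
      refine mul_le_mul_of_nonneg_left ?_ hα
      have h := geom_sum_Ico_le_of_lt_one (m := 0) (n := n + 1) hϱ0 hϱ1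
      rw [pow_zero] at h
      rw [Finset.range_eq_Ico]
      exact h.trans (le_of_eq (by ring))
    exact h1.trans h2
  have hLQU : ∀ (w : TSite d m) (g : BondL2K ℂ d (towerP L m (n + 1)) c₀ W) (F : ℝ), (∀ x, piB x ≠ w → WL2.equiv ℂ (fun _ : Bond d (towerP L m (n + 1)) => c₀) W g x = 0) →
      (∀ x, ‖WL2.equiv ℂ (fun _ : Bond d (towerP L m (n + 1)) => c₀) W g x‖ ≤ F) → ∀ c', ‖WL2.equiv ℂ (fun _ : Bond d m => c₁) W (TQU g) c'‖ ≤ KQU * Real.exp (-(κ₀ * tdist m (piC c') w)) * F := by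
    intro w g F hgv hgF c'
    have hF : 0 ≤ F := (norm_nonneg _).trans (hgF bd)
    rw [hTQU, LinearMap.coe_toContinuousLinearMap']
    have h := local_QkW L m n φ U hL αU hα1 hU1 hreg (c₀ := c₀) (c₁ := c₁) hφ hφ' hMφ hMφ' hm hκ₀0.le w g F hgv hgF c'
    refine h.trans ?_
    have hE0 : 0 ≤ Real.exp κ₀ * Real.exp (-(κ₀ * tdist m (bpos c') w)) * F := by positivity
    calc Mφ' * Mφ * (∏ j ∈ Finset.range (n + 1), (1 + 50 * ((d : ℝ) + 1) * αU j)) * Real.exp κ₀ * Real.exp (-(κ₀ * tdist m (bpos c') w)) * F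
        = (Mφ' * Mφ) * (∏ j ∈ Finset.range (n + 1), (1 + 50 * ((d : ℝ) + 1) * αU j)) * (Real.exp κ₀ * Real.exp (-(κ₀ * tdist m (bpos c') w)) * F) := by ring
      _ ≤ (Mφ' * Mφ) * EQ * (Real.exp κ₀ * Real.exp (-(κ₀ * tdist m (bpos c') w)) * F) :=
          mul_le_mul_of_nonneg_right (mul_le_mul_of_nonneg_left hPA (mul_nonneg hMφ' hMφ)) hE0
      _ = KQU * Real.exp (-(κ₀ * tdist m (piC c') w)) * F := by rw [hKQU, hpiC]; simp only [bpos]; ring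
  have hLQ1 : ∀ (w : TSite d m) (g : BondL2K ℂ d (towerP L m (n + 1)) c₀ W) (F : ℝ), (∀ x, piB x ≠ w → WL2.equiv ℂ (fun _ : Bond d (towerP L m (n + 1)) => c₀) W g x = 0) →
      (∀ x, ‖WL2.equiv ℂ (fun _ : Bond d (towerP L m (n + 1)) => c₀) W g x‖ ≤ F) → ∀ c', ‖WL2.equiv ℂ (fun _ : Bond d m => c₁) W (TQ1 g) c'‖ ≤ KQ1 * Real.exp (-(κ₀ * tdist m (piC c') w)) * F := by
    intro w g F hgv hgF c'
    rw [hTQ1, LinearMap.coe_toContinuousLinearMap']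
    have h := local_QkW L m n φ (fun _ : Bond d (towerP L m (n + 1)) => (1 : 𝔸ˣ)) hL (fun _ => 0) (fun _ => by norm_num)
                (perCfg_UlevOf_one_mem_U1 L m (n + 1)) (norm_Wcx_UlevOf_one_sub_one_le L m (n + 1) (fun _ => 0) (fun _ => le_rfl)) (c₀ := c₀) (c₁ := c₁)
      hφ hφ' hMφ hMφ' hm hκ₀0.le w g F hgv hgF c'
    simp only [mul_zero, add_zero, Finset.prod_const_one, mul_one] at h
    exact h.trans (le_of_eq (by rw [hKQ1]))
  have hLQd : ∀ (w : TSite d m) (g : BondL2K ℂ d (towerP L m (n + 1)) c₀ W) (F : ℝ), (∀ x, piB x ≠ w → WL2.equiv ℂ (fun _ : Bond d (towerP L m (n + 1)) => c₀) W g x = 0) →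
      (∀ x, ‖WL2.equiv ℂ (fun _ : Bond d (towerP L m (n + 1)) => c₀) W g x‖ ≤ F) → ∀ c', ‖WL2.equiv ℂ (fun _ : Bond d m => c₁) W (TQd g) c'‖ ≤ (KQd * α) * Real.exp (-(κ₀ * tdist m (piC c') w)) * F := by
    intro w g F hgv hgF c'
    have hF : 0 ≤ F := (norm_nonneg _).trans (hgF bd)
    rw [hTQd, LinearMap.coe_toContinuousLinearMap', LinearMap.sub_apply, WL2.equiv_sub, Pi.sub_apply]
    have h := local_QkW_sub_flat L m n φ U hL αU hα0 hα1 hU1 hreg εU hεU hUε (c₀ := c₀) (c₁ := c₁) hφ hφ' hMφ hMφ' hm hκ₀0.le w g hF hgv hgF c'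
    refine h.trans ?_
    calc Mφ' * Mφ * ((∏ j ∈ Finset.range (n + 1), (1 + 50 * ((d : ℝ) + 1) * αU j)) * (102 * ((d : ℝ) + 1) ^ 2 * L) * (∑ j ∈ Finset.range (n + 1), εU j)) *
          Real.exp κ₀ * Real.exp (-(κ₀ * tdist m (bpos c') w)) * F
        = Mφ' * Mφ * ((∏ j ∈ Finset.range (n + 1), (1 + 50 * ((d : ℝ) + 1) * αU j)) * θ * (∑ j ∈ Finset.range (n + 1), εU j)) *
          (Real.exp κ₀ * Real.exp (-(κ₀ * tdist m (bpos c') w)) * F) := by rw [hθ]; ring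
      _ ≤ Mφ' * Mφ * (EQ * θ * (α * (1 / (1 - ϱ)))) * (Real.exp κ₀ * Real.exp (-(κ₀ * tdist m (bpos c') w)) * F) := by
          have hP0 : 0 ≤ ∏ j ∈ Finset.range (n + 1), (1 + 50 * ((d : ℝ) + 1) * αU j) := Finset.prod_nonneg fun j _ => by have := hα0 j; positivity
          have hS0' : 0 ≤ ∑ j ∈ Finset.range (n + 1), εU j := Finset.sum_nonneg fun j _ => hεU j
          gcongr
      _ = (KQd * α) * Real.exp (-(κ₀ * tdist m (piC c') w)) * F := by rw [hKQd, hpiC]; simp only [bpos]; ring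
  have hLHd : ∀ (w : TSite d m) (z : BondL2K ℂ d m c₁ W) (H : ℝ), (∀ c', piC c' ≠ w → WL2.equiv ℂ (fun _ : Bond d m => c₁) W z c' = 0) → (∀ c', ‖WL2.equiv ℂ (fun _ : Bond d m => c₁) W z c'‖ ≤ H) →
      ∀ b', ‖WL2.equiv ℂ (fun _ : Bond d (towerP L m (n + 1)) => c₀) W ((Dcl1 ∘L THd) z) b'‖ ≤ ((j₀ + α) * KP) * Real.exp (-(κ₀ * tdist m (piT b') w)) * H := by
    intro w z H hzv hzF b'
    have hH : 0 ≤ H := (norm_nonneg _).trans (hzF (w, ⟨0, hd⟩))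
    rw [ContinuousLinearMap.comp_apply, hDcl1, hTHd, LinearMap.coe_toContinuousLinearMap', LinearMap.sub_apply, ← covGrad_apply_eq_slice]
    refine (HPH n η hηL c₀ c₁ hw hρ m hm U αU hα0 hα1 hαL hU1 hreg εU hεU hε1 hUε hLb α hα hαP' hUst hUb hUη hUw hpl hUgrad hRlev hεg hAQ hpos' hpos hc₀η j₀ hJ hjP'
      hposπ hQ hpos'₁ hpos₁ w z H hzv hzF μ b').trans ?_
    exact mul_le_mul_of_nonneg_right (mul_le_mul_of_nonneg_left (hweak _ hκ₀P (tdist_nonneg m _ _)) (mul_nonneg (add_nonneg hj₀ hα) hKP)) hH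
  have hLH1 : ∀ (w : TSite d m) (z : BondL2K ℂ d m c₁ W) (H : ℝ), (∀ c', piC c' ≠ w → WL2.equiv ℂ (fun _ : Bond d m => c₁) W z c' = 0) → (∀ c', ‖WL2.equiv ℂ (fun _ : Bond d m => c₁) W z c'‖ ≤ H) →
      ∀ b', ‖WL2.equiv ℂ (fun _ : Bond d (towerP L m (n + 1)) => c₀) W ((Dcl1 ∘L TH1) z) b'‖ ≤ BH' * Real.exp (-(κ₀ * tdist m (piT b') w)) * H := by
    intro w z H hzv hzF b'
    have hH : 0 ≤ H := (norm_nonneg _).trans (hzF (w, ⟨0, hd⟩))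
    rw [ContinuousLinearMap.comp_apply, hDcl1, hTH1, LinearMap.coe_toContinuousLinearMap']
    refine ((ROWH n η hηL c₀ c₁ hw hρ m hm (fun _ : Bond d (towerP L m (n + 1)) => (1 : 𝔸ˣ)) (fun _ => 0) (fun _ => le_rfl) (fun _ => by norm_num) hαL1
      (perCfg_UlevOf_one_mem_U1 L m (n + 1)) (norm_Wcx_UlevOf_one_sub_one_le L m (n + 1) (fun _ => 0) (fun _ => le_rfl)) (fun _ => 0) (fun _ => le_rfl) hUε1 hLb1
      0 le_rfl hαH.le hUst1 hUb1 hUη1 hpl1 hUgrad1 hRlev1 hεg1 hAQ1 hpos'₁ hpos₁ w z H hzv hzF μ b').1).trans ?_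
    have hDB := tdist_nonneg m (piB b') w
    have hTB : tdist m (piT b') w ≤ tdist m (piB b') w + 1 := by
      have h := tdist_triangle hm (piT b') (piB b') w
      have h1 : tdist m (piT b') (piB b') ≤ 1 := by rw [tdist_symm hm]; exact hone b'
      linarith
    have hexp : Real.exp (-(δH * tdist m (piB b') w)) ≤ Real.exp κ₀ * Real.exp (-(κ₀ * tdist m (piT b') w)) := by
      rw [← Real.exp_add]
      refine Real.exp_le_exp.mpr ?_
      nlinarith [mul_le_mul_of_nonneg_right hκ₀H hDB, mul_le_mul_of_nonneg_left hTB hκ₀0.le]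
    calc BH * Real.exp (-(δH * tdist m (blockCoord (L ^ (n + 1)) m (siteCast (towerP_eq_fineP_pow L m (n + 1)) (bpos b'))) w)) * H
        ≤ BH * (Real.exp κ₀ * Real.exp (-(κ₀ * tdist m (piT b') w))) * H := mul_le_mul_of_nonneg_right (mul_le_mul_of_nonneg_left hexp hBH) hH
      _ = BH' * Real.exp (-(κ₀ * tdist m (piT b') w)) * H := by rw [hBH']; ring
  have hrow : ∀ w : TSite d m, ∑ u, Real.exp (-((κ₀ - κ₀ / 2) * tdist m w u)) ≤ S := fun w => by
    rw [show κ₀ - κ₀ / 2 = κ₀ / 2 by ring]; exact torusSum_le d hm (half_pos hκ₀0) w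
  have hδ0 : ∀ u v : TSite d m, 0 ≤ tdist m u v := fun u v => tdist_nonneg _ _ _
  have hδt : ∀ u y v : TSite d m, tdist m u v ≤ tdist m u y + tdist m y v := fun u y v => tdist_triangle hm u y v
  have hκ'0 : (0 : ℝ) ≤ κ₀ / 2 := by positivity
  have hκ'1 : κ₀ / 2 ≤ κ₀ := by linarith
  have hW1a := letter_comp (𝕜 := ℂ) (tdist m) piB piB piC TGt TQU hδ0 hδt hBT hKQU0 hκ'0 hκ'1 hLGt hLQU hrow
  have hW1 := letter_comp (𝕜 := ℂ) (tdist m) piB piC piT (TQU ∘L TGt) (Dcl1 ∘L THd) hδ0 hδt (by positivity) (mul_nonneg (add_nonneg hj₀ hα) hKP) hκ'0 le_rfl hW1a hLHd hrow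
  have hW2a := letter_comp (𝕜 := ℂ) (tdist m) piB piB piC TGt TQd hδ0 hδt hBT (mul_nonneg hKQd0 hα) hκ'0 hκ'1 hLGt hLQd hrow
  have hW2 := letter_comp (𝕜 := ℂ) (tdist m) piB piC piT (TQd ∘L TGt) (Dcl1 ∘L TH1) hδ0 hδt (by positivity) hBH'0 hκ'0 le_rfl hW2a hLH1 hrow
  have hW3a := letter_comp (𝕜 := ℂ) (tdist m) piB piB piC TGdd TQ1 hδ0 hδt (by positivity) hKQ10 hκ'0 hκ'1 hLGdd hLQ1 hrow
  have hW3 := letter_comp (𝕜 := ℂ) (tdist m) piB piC piT (TQ1 ∘L TGdd) (Dcl1 ∘L TH1) hδ0 hδt (by positivity) hBH'0 hκ'0 le_rfl hW3a hLH1 hrow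
  have hW12 := letter_add (𝕜 := ℂ) (tdist m) piB piT _ _ hW1 hW2
  have hW := letter_add (𝕜 := ℂ) (tdist m) piB piT _ _ hW12 hW3 v f F hfv hfF bd
  have hsplit0 : HP (QU (Gt f)) - H1 (Q1 (G1 f)) =
      (((THd ∘L (TQU ∘L TGt)) + (TH1 ∘L (TQd ∘L TGt))) + (TH1 ∘L (TQ1 ∘L TGdd))) f := by
    simp only [add_apply, ContinuousLinearMap.coe_comp, Function.comp_apply]
    rw [hTHd, hTH1, hTQU, hTQ1, hTQd, hTGt, hTGdd]
    simp only [LinearMap.coe_toContinuousLinearMap']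
    simp only [LinearMap.sub_apply, map_sub]
    abel
  have hsplit : Dcl1 (HP (QU (Gt f)) - H1 (Q1 (G1 f))) =
      ((((Dcl1 ∘L THd) ∘L (TQU ∘L TGt)) + ((Dcl1 ∘L TH1) ∘L (TQd ∘L TGt))) + ((Dcl1 ∘L TH1) ∘L (TQ1 ∘L TGdd))) f := by
    rw [hsplit0]
    simp only [add_apply, ContinuousLinearMap.coe_comp, Function.comp_apply, map_add]
  refine norm_covGrad_apply_le_of_slice _ _ _ bd μ ?_
  rw [← hDcl1 _ bd, hsplit]
  refine hW.trans ?_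
  set E : ℝ := Real.exp (-(κ₀ / 2 * tdist m (piT bd) v)) with hE
  have hE0 : 0 ≤ E := Real.exp_nonneg _
  have h1 : BT * KQU * S * ((j₀ + α) * KP) * S = (j₀ + α) * (BT * KQU * S * KP * S) := by ring
  have hX2 : 0 ≤ BT * KQd * S * BH' * S := by positivity
  have h2 : BT * (KQd * α) * S * BH' * S ≤ (j₀ + α) * (BT * KQd * S * BH' * S) := by
    have e : BT * (KQd * α) * S * BH' * S = α * (BT * KQd * S * BH' * S) := by ring
    rw [e]
    linarith [mul_nonneg hj₀ hX2]
  have hY1 : 0 ≤ BR * KQ1 * S * BH' * S := by positivity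
  have hY2 : 0 ≤ KS * KQ1 * S * BH' * S := by positivity
  have h3 : (α' * BR + KS * α) * KQ1 * S * BH' * S ≤ (j₀ + α) * ((BR + KS) * KQ1 * S * BH' * S) := by
    have e : (α' * BR + KS * α) * KQ1 * S * BH' * S = α' * (BR * KQ1 * S * BH' * S) + α * (KS * KQ1 * S * BH' * S) := by ring
    have e' : (j₀ + α) * ((BR + KS) * KQ1 * S * BH' * S) = (j₀ + α) * (BR * KQ1 * S * BH' * S) + (j₀ + α) * (KS * KQ1 * S * BH' * S) := by ring
    rw [e, e']
    have ha := mul_le_mul_of_nonneg_right hα'le hY1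
    linarith [mul_nonneg hj₀ hY2]
  have hKexp : (j₀ + α) * K = (j₀ + α) * (BT * KQU * S * KP * S) + (j₀ + α) * (BT * KQd * S * BH' * S) + (j₀ + α) * ((BR + KS) * KQ1 * S * BH' * S) := by
    rw [hK]; ring
  have hsum : (BT * KQU * S * ((j₀ + α) * KP) * S + BT * (KQd * α) * S * BH' * S + (α' * BR + KS * α) * KQ1 * S * BH' * S) ≤ (j₀ + α) * K := by
    rw [hKexp, h1]; linarith
  exact mul_le_mul_of_nonneg_right (mul_le_mul_of_nonneg_right hsum hE0) hF

end Literature.MathematicalPhysics.QuantumFieldTheory.Balaban1983to89.B9Eq3153FrakGkPiMiddleWordTwoBackgroundGradientLetterTower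

end
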